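import Summits.ValiantsHypothesis.ValiantsHypothesis.Theorems.LacunarySymmetroidMatrixDescartesDoorA26WallBubblingMixGram
import Summits.ValiantsHypothesis.ValiantsHypothesis.Theorems.LacunarySymmetroidMatrixDescartesDoorA26WallBubblingNullCollapse

/-!
# Wall bubbling for `DoorA26` — WEYL TRIPLES: THE NULL VARIETY OF A CONFLUENT TRIPLE BLOCK (located algebra for `TripleStratum26`)

HONEST FRAMING.  `TripleStratum26` of `Cruxes/DoorA26/Lines/wall_bubbling_ConfluentDoor.lean` (rev 7; crux `DoorA26`, stmt-ValiantsHypothesis-19979 —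
OPEN, typed, never asserted) is the one hypothesis of the (W) ledger «(W) ⟸ ConfluentDoor26 ∧ NoTightChain26NC ∧ (M) ∧ TripleStratum26» nobody has
touched.  W1 seat val-sym-door-p2 g14, LOCATED ALGEBRA ONLY (memo `HOME/val-sym-door-p2/g14/TRIPLE-STRATUM-SCOPE.md`): at a Weyl triple the confluent
(Newton) block of the limit pencil is `A + t•B + t²•C`, and

* `det_tripleBlock_expand` — `det(A + tB + t²C) = det A + 2·polar(A,B)·t + (2·polar(A,C) + det B)·t² + 2·polar(B,C)·t³ + det C·t⁴` (all matrices):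
  the `t²`-slot carries TWO Gram entries — the line file's «cancelling pattern `2E_ac − E_bb`»;
* `eq_zero_of_polar_tripleJet_eq_zero` — THE NON-COLLAPSED NULL BLOCK IS A POLAR-BASIS: if symmetric `A, B, C` satisfy `det A = 0`, `polar(A,B) = 0`,
  `2·polar(A,C) + det B = 0` with `polar(A,C) ≠ 0` (the rank-one 2-jets `uuᵀ, uvᵀ+vuᵀ, vvᵀ`, `u ∧ v ≠ 0`, are of this kind), then a symmetric `W` with
  `polar(W,A) = polar(W,B) = polar(W,C) = 0` is ZERO (coordinate Gram identity `Δ² = (2·polar(A,C))³` and Cramer) — so in a degenerate normalised limit of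
  this type EVERY OTHER LETTER VANISHES (each mixed class `α + δ_x` has members of confluent degrees 0,1,2, whose coefficients are these three polars);
* `polar_pos_of_tripleJet` — in that case `0 < polar(A,C)` and `det B < 0`;
* `tripleBlock_collapse` — the complementary case `polar(A,C) = 0`: the five slot equations force W2's NULL COLLAPSE (`A, B, C` multiples of one singular
  symmetric matrix, or all zero).

Def-free; nothing here is a step of a proof of `TripleStratum26` yet (the analysis — a second blow-up — is the planner's); nothing bears on `DoorA26`,
`MatrixDescartes` (stmt-ValiantsHypothesis-18050) or `VP ≠ VNP`.  `--supports stmt-ValiantsHypothesis-19979 --as helper`.  [folklore] `2 × 2` algebra.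
-/

-- `Summit.ValiantsHypothesis.ValiantsHypothesis.…` repeats a component by the D-0017 layout
-- (single-conjunct summit), which the `dupNamespace` linter flags; the name is mandated.
set_option linter.dupNamespace false

namespace Summit.ValiantsHypothesis.ValiantsHypothesis.Theorems.LacunarySymmetroidMatrixDescartes.WallBubbling

open Bubbling (polar polar_apply)

/-- **The determinant of a confluent triple block**: `det(A + tB + t²C)` slot by slot; the `t²`-slot is `2·polar(A,C) + det B`. [folklore] -/
theorem det_tripleBlock_expand (A B C : Matrix (Fin 2) (Fin 2) ℝ) (t : ℝ) :
    (A + t • B + t ^ 2 • C).det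
      = A.det + 2 * polar A B * t + (2 * polar A C + B.det) * t ^ 2 + 2 * polar B C * t ^ 3 + C.det * t ^ 4 := by
  simp only [polar_apply, Matrix.det_fin_two, Matrix.add_apply, Matrix.smul_apply, smul_eq_mul]
  ring

/-- Off-diagonal symmetry of a symmetric `2 × 2` matrix. [folklore] -/
theorem apply_one_zero_of_isSymm {S : Matrix (Fin 2) (Fin 2) ℝ} (hS : S.IsSymm) : S 1 0 = S 0 1 := by
  have := congrFun (congrFun hS 0) 1
  simpa [Matrix.transpose_apply] using this

/-- **THE NON-COLLAPSED NULL TRIPLE BLOCK IS A POLAR BASIS.**  Symmetric `A, B, C` with `det A = 0`, `polar(A,B) = 0`, `2·polar(A,C) + det B = 0`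
and `polar(A,C) ≠ 0`: a symmetric `W` polar-orthogonal to `A`, `B`, `C` vanishes. [this work] -/
theorem eq_zero_of_polar_tripleJet_eq_zero (A B C W : Matrix (Fin 2) (Fin 2) ℝ)
    (hA : A.IsSymm) (hB : B.IsSymm) (hC : C.IsSymm) (hW : W.IsSymm)
    (hdA : A.det = 0) (hAB : polar A B = 0) (hq : 2 * polar A C + B.det = 0) (hp : polar A C ≠ 0)
    (hWA : polar W A = 0) (hWB : polar W B = 0) (hWC : polar W C = 0) : W = 0 := by
  have a10 := apply_one_zero_of_isSymm hA
  have b10 := apply_one_zero_of_isSymm hB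
  have c10 := apply_one_zero_of_isSymm hC
  have w10 := apply_one_zero_of_isSymm hW
  rw [polar_apply, a10, b10] at hAB
  rw [polar_apply, a10, c10, Matrix.det_fin_two, b10] at hq
  rw [Matrix.det_fin_two, a10] at hdA
  rw [polar_apply, a10, c10] at hp
  rw [polar_apply, w10, a10] at hWA
  rw [polar_apply, w10, b10] at hWB
  rw [polar_apply, w10, c10] at hWC
  -- the coordinate Gram identity `Δ² = q³`, `q = 2·polar(A,C)`
  set q : ℝ := A 0 0 * C 1 1 + C 0 0 * A 1 1 - 2 * A 0 1 * C 0 1 with hqdef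
  set Δ : ℝ := A 0 0 * (B 0 1 * C 1 1 - B 1 1 * C 0 1) - A 0 1 * (B 0 0 * C 1 1 - B 1 1 * C 0 0)
    + A 1 1 * (B 0 0 * C 0 1 - B 0 1 * C 0 0) with hΔdef
  have hq0 : q ≠ 0 := by
    intro h0; apply hp; rw [show A 0 0 * C 1 1 + C 0 0 * A 1 1 - A 0 1 * C 0 1 - C 0 1 * A 0 1 = q by rw [hqdef]; ring, h0, zero_div]
  have hdA' : A 0 0 * A 1 1 - A 0 1 ^ 2 = 0 := by linear_combination hdA
  have hAB' : A 0 0 * B 1 1 + B 0 0 * A 1 1 - 2 * A 0 1 * B 0 1 = 0 := by linear_combination 2 * hAB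
  have hqB : q + (B 0 0 * B 1 1 - B 0 1 ^ 2) = 0 := by linear_combination hq
  have key : Δ ^ 2 = q ^ 3 := by
    linear_combination (2 * (2 * (B 0 0 * B 1 1 - B 0 1 ^ 2)) * (C 0 0 * C 1 1 - C 0 1 ^ 2)
        - (B 0 0 * C 1 1 + C 0 0 * B 1 1 - 2 * B 0 1 * C 0 1) ^ 2) * hdA'
      + (-(A 0 0 * B 1 1 + B 0 0 * A 1 1 - 2 * A 0 1 * B 0 1) * (C 0 0 * C 1 1 - C 0 1 ^ 2)
        + q * (B 0 0 * C 1 1 + C 0 0 * B 1 1 - 2 * B 0 1 * C 0 1)) * hAB'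
      + (-q ^ 2) * hqB
  have hΔ : Δ ≠ 0 := by
    intro h0
    have : q ^ 3 = 0 := by rw [← key, h0]; ring
    exact hq0 (pow_eq_zero_iff (n := 3) (by norm_num) |>.mp this)
  -- Cramer: `2Δ · w_k = Σ_X cofactor · (2·polar(W,X)) = 0`
  have LA : W 0 0 * A 1 1 + A 0 0 * W 1 1 - 2 * W 0 1 * A 0 1 = 0 := by linear_combination 2 * hWA
  have LB : W 0 0 * B 1 1 + B 0 0 * W 1 1 - 2 * W 0 1 * B 0 1 = 0 := by linear_combination 2 * hWB
  have LC : W 0 0 * C 1 1 + C 0 0 * W 1 1 - 2 * W 0 1 * C 0 1 = 0 := by linear_combination 2 * hWC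
  have h00 : (2 * Δ) * W 0 0 = 0 := by
    linear_combination (2 * (B 0 0 * C 0 1 - B 0 1 * C 0 0)) * LA + (2 * (A 0 1 * C 0 0 - A 0 0 * C 0 1)) * LB
      + (2 * (A 0 0 * B 0 1 - A 0 1 * B 0 0)) * LC
  have h01 : (2 * Δ) * W 0 1 = 0 := by
    linear_combination (B 0 0 * C 1 1 - B 1 1 * C 0 0) * LA + (A 1 1 * C 0 0 - A 0 0 * C 1 1) * LB
      + (A 0 0 * B 1 1 - A 1 1 * B 0 0) * LC
  have h11 : (2 * Δ) * W 1 1 = 0 := by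
    linear_combination (2 * (B 0 1 * C 1 1 - B 1 1 * C 0 1)) * LA + (2 * (A 1 1 * C 0 1 - A 0 1 * C 1 1)) * LB
      + (2 * (A 0 1 * B 1 1 - A 1 1 * B 0 1)) * LC
  have h2Δ : (2 * Δ) ≠ 0 := mul_ne_zero two_ne_zero hΔ
  have e00 : W 0 0 = 0 := (mul_eq_zero.mp h00).resolve_left h2Δ
  have e01 : W 0 1 = 0 := (mul_eq_zero.mp h01).resolve_left h2Δ
  have e11 : W 1 1 = 0 := (mul_eq_zero.mp h11).resolve_left h2Δ
  ext i j
  fin_cases i <;> fin_cases j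
  · exact e00
  · exact e01
  · simpa [w10] using e01
  · exact e11

/-- In the non-collapsed null block, `polar(A,C) > 0` and `det B < 0` (`B` is a genuine `uvᵀ + vuᵀ`). [this work] -/
theorem polar_pos_of_tripleJet (A B C : Matrix (Fin 2) (Fin 2) ℝ) (hA : A.IsSymm) (hB : B.IsSymm) (hC : C.IsSymm)
    (hdA : A.det = 0) (hAB : polar A B = 0) (hq : 2 * polar A C + B.det = 0) (hp : polar A C ≠ 0) :
    0 < polar A C ∧ B.det < 0 := by
  have a10 := apply_one_zero_of_isSymm hA
  have b10 := apply_one_zero_of_isSymm hB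
  have c10 := apply_one_zero_of_isSymm hC
  have hpA : polar A C = (A 0 0 * C 1 1 + C 0 0 * A 1 1 - 2 * A 0 1 * C 0 1) / 2 := by
    rw [polar_apply, a10, c10]; ring
  rw [polar_apply, a10, b10] at hAB
  rw [hpA, Matrix.det_fin_two, b10] at hq
  rw [Matrix.det_fin_two, a10] at hdA
  set q : ℝ := A 0 0 * C 1 1 + C 0 0 * A 1 1 - 2 * A 0 1 * C 0 1 with hqdef
  set Δ : ℝ := A 0 0 * (B 0 1 * C 1 1 - B 1 1 * C 0 1) - A 0 1 * (B 0 0 * C 1 1 - B 1 1 * C 0 0)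
    + A 1 1 * (B 0 0 * C 0 1 - B 0 1 * C 0 0) with hΔdef
  have hq0 : q ≠ 0 := by
    intro h0; apply hp; rw [hpA, h0, zero_div]
  have hdA' : A 0 0 * A 1 1 - A 0 1 ^ 2 = 0 := by linear_combination hdA
  have hAB' : A 0 0 * B 1 1 + B 0 0 * A 1 1 - 2 * A 0 1 * B 0 1 = 0 := by linear_combination 2 * hAB
  have hqB : q + (B 0 0 * B 1 1 - B 0 1 ^ 2) = 0 := by linear_combination hq
  have key : Δ ^ 2 = q ^ 3 := by
    linear_combination (2 * (2 * (B 0 0 * B 1 1 - B 0 1 ^ 2)) * (C 0 0 * C 1 1 - C 0 1 ^ 2)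
        - (B 0 0 * C 1 1 + C 0 0 * B 1 1 - 2 * B 0 1 * C 0 1) ^ 2) * hdA'
      + (-(A 0 0 * B 1 1 + B 0 0 * A 1 1 - 2 * A 0 1 * B 0 1) * (C 0 0 * C 1 1 - C 0 1 ^ 2)
        + q * (B 0 0 * C 1 1 + C 0 0 * B 1 1 - 2 * B 0 1 * C 0 1)) * hAB'
      + (-q ^ 2) * hqB
  have hqpos : 0 < q := by
    rcases lt_or_gt_of_ne hq0 with hneg | hpos
    · exfalso
      have h3 : q ^ 3 < 0 := by
        have : 0 < (-q) ^ 3 := pow_pos (neg_pos.mpr hneg) 3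
        nlinarith [this]
      nlinarith [sq_nonneg Δ, key]
    · exact hpos
  refine ⟨by rw [hpA]; positivity, ?_⟩
  rw [Matrix.det_fin_two, b10]
  nlinarith [hqB, hqpos]

/-- **THE COLLAPSED NULL BLOCK.**  If `polar(A,C) = 0` too, the five slot equations say `A, B, C` are singular and pairwise polar-orthogonal,
and W2's null collapse makes them multiples of one singular symmetric matrix (or all zero). [this work] -/
theorem tripleBlock_collapse (A B C : Matrix (Fin 2) (Fin 2) ℝ) (hA : A.IsSymm) (hB : B.IsSymm) (hC : C.IsSymm)
    (hdA : A.det = 0) (hAB : polar A B = 0) (hq : 2 * polar A C + B.det = 0) (hBC : polar B C = 0) (hdC : C.det = 0)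
    (hp : polar A C = 0) :
    (A = 0 ∧ B = 0 ∧ C = 0) ∨
      ∃ N : Matrix (Fin 2) (Fin 2) ℝ, N ≠ 0 ∧ N.IsSymm ∧ N.det = 0 ∧ ∃ a b c : ℝ, A = a • N ∧ B = b • N ∧ C = c • N := by
  have hdB : B.det = 0 := by linear_combination hq - 2 * hp
  -- raw forms of the dead pairings, as `exists_smul_of_polar_eq_zero` wants them
  have rAB : ((A + B).det - A.det - B.det) / 2 = 0 := hAB
  have rBA : ((B + A).det - B.det - A.det) / 2 = 0 := by rw [add_comm]; linear_combination rAB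
  have rAC : ((A + C).det - A.det - C.det) / 2 = 0 := hp
  have rCA : ((C + A).det - C.det - A.det) / 2 = 0 := by rw [add_comm]; linear_combination rAC
  have rBC : ((B + C).det - B.det - C.det) / 2 = 0 := hBC
  have rCB : ((C + B).det - C.det - B.det) / 2 = 0 := by rw [add_comm]; linear_combination rBC
  by_cases hA0 : A = 0
  · by_cases hB0 : B = 0
    · by_cases hC0 : C = 0
      · exact Or.inl ⟨hA0, hB0, hC0⟩
      · refine Or.inr ⟨C, hC0, hC, hdC, 0, 0, 1, ?_, ?_, (one_smul _ _).symm⟩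
        · rw [hA0, zero_smul]
        · rw [hB0, zero_smul]
    · obtain ⟨c, hc⟩ := exists_smul_of_polar_eq_zero hC hB hdC hdB hB0 rCB
      refine Or.inr ⟨B, hB0, hB, hdB, 0, 1, c, ?_, (one_smul _ _).symm, hc⟩
      rw [hA0, zero_smul]
  · obtain ⟨b, hb⟩ := exists_smul_of_polar_eq_zero hB hA hdB hdA hA0 rBA
    obtain ⟨c, hc⟩ := exists_smul_of_polar_eq_zero hC hA hdC hdA hA0 rCA
    exact Or.inr ⟨A, hA0, hA, hdA, 1, b, c, (one_smul _ _).symm, hb, hc⟩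

end Summit.ValiantsHypothesis.ValiantsHypothesis.Theorems.LacunarySymmetroidMatrixDescartes.WallBubbling
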